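import Mathlib.Analysis.Distribution.SchwartzSpace.Fourier
import Mathlib.MeasureTheory.Function.L2Space
import Mathlib.MeasureTheory.Group.Prod
import HarnessLib

/-!
# The frequency-side kernel of `[H, f]` is square-integrable on `ℝ²`

RH-FREE analysis (cell `rh-crit`, sub-cell cc, seat t13; a brick of the planned discharge of the tree fact
`CC2021_lemma_D47`, App. D Lemma D.1 (47) of Connes–Consani 2021).  By `QuantizedDiffKernelFourier`
(`quantizedDiffKernel_eq_integral_integral_quadrant`) the position kernel of `[H, f]` is `−2×` the inverse-Fourier
conjugate of the frequency kernel `b_f(ξ,η) = f̂(ξ−η)(1_{ξ>0≥η} − 1_{ξ≤0<η})`, supported on the off-diagonal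
quadrants where `|ξ−η| = |ξ| + |η|`.  Here: `b_f ∈ L²(ℝ²)` (indeed `∫∫|b_f|² = ∫|u||f̂(u)|²du`), the hypothesis
under which `KernelApproxNumberBound` turns separable approximations of `b_f` into approximation-number bounds
(App. D Rem. 48's "direct kernel estimate", p. 33 L39–41); and `b_f ∈ L¹(ℝ²)` (`integrable_quadrantKernel`), the
absolute convergence used when `[H,f]` is identified with `𝓕⁻¹ B 𝓕` on test functions.  WHAT THIS IS NOT: any
claim about RH.
Theorems only; no definition, no named fact (net debt 0).
-/

noncomputable section

open MeasureTheory Complex Set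
open scoped Real FourierTransform

namespace Literature.NumberTheory.ConnesConsani2021

/-- RH-FREE. Joint measurability of the frequency-side kernel `b_f(ξ,η) = f̂(ξ−η)(1_{ξ>0≥η} − 1_{ξ≤0<η})`.
[cite: ConnesConsani2021, App. D Lemma 47 proof p. 33 (arXiv chunk p0033:L24–36)] -/
theorem measurable_quadrantKernel (f : SchwartzMap ℝ ℂ) :
    Measurable (Function.uncurry fun ξ η : ℝ => 𝓕 (f : ℝ → ℂ) (ξ - η) *
      ((if 0 < ξ ∧ η ≤ 0 then (1 : ℂ) else 0) - (if ξ ≤ 0 ∧ 0 < η then (1 : ℂ) else 0))) := by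
  have hFcont : Continuous (𝓕 (f : ℝ → ℂ)) := by
    simpa [SchwartzMap.fourier_coe] using (𝓕 f).continuous
  refine (hFcont.measurable.comp (measurable_fst.sub measurable_snd)).mul (Measurable.sub ?_ ?_)
  · refine Measurable.ite ?_ measurable_const measurable_const
    exact (measurableSet_lt measurable_const measurable_fst).inter
      (measurableSet_le measurable_snd measurable_const)
  · refine Measurable.ite ?_ measurable_const measurable_const
    exact (measurableSet_le measurable_fst measurable_const).inter
      (measurableSet_lt measurable_const measurable_snd)

/-- RH-FREE. **The frequency-side kernel of `[H, f]` is Hilbert–Schmidt**: `b_f ∈ L²(ℝ × ℝ)` for `f ∈ 𝒮(ℝ)`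
(on the quadrants `|b_f(ξ,η)| = |f̂(ξ−η)|` with `|η| ≤ |ξ−η|`, and `∫∫ |f̂(u)|² 1_{|η|≤|u|} dη du = ∫ 2|u||f̂(u)|² du
< ∞`).  [cite: ConnesConsani2021, App. D Lemma 47 proof p. 33 (arXiv chunk p0033:L24–36) and Rem. 48 (L39–41)] -/
theorem memLp_two_quadrantKernel (f : SchwartzMap ℝ ℂ) :
    MemLp (Function.uncurry fun ξ η : ℝ => 𝓕 (f : ℝ → ℂ) (ξ - η) *
      ((if 0 < ξ ∧ η ≤ 0 then (1 : ℂ) else 0) - (if ξ ≤ 0 ∧ 0 < η then (1 : ℂ) else 0)))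
      2 ((volume : Measure ℝ).prod volume) := by
  have hFcont : Continuous (𝓕 (f : ℝ → ℂ)) := by
    simpa [SchwartzMap.fourier_coe] using (𝓕 f).continuous
  -- `f̂` is bounded and `|u| |f̂(u)|` is integrable
  obtain ⟨C0, hC0⟩ : ∃ C : ℝ, ∀ u : ℝ, ‖𝓕 (f : ℝ → ℂ) u‖ ≤ C := by
    refine ⟨SchwartzMap.seminorm ℝ 0 0 (𝓕 f), fun u => ?_⟩
    have h := SchwartzMap.norm_le_seminorm ℝ (𝓕 f) u
    rwa [show ((𝓕 f : SchwartzMap ℝ ℂ) : ℝ → ℂ) u = 𝓕 (f : ℝ → ℂ) u from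
      congrFun (SchwartzMap.fourier_coe f) u] at h
  have hC0nn : 0 ≤ C0 := (norm_nonneg _).trans (hC0 0)
  have hF1 : Integrable (fun u : ℝ => |u| * ‖𝓕 (f : ℝ → ℂ) u‖) := by
    have h := (𝓕 f).integrable_pow_mul (volume : Measure ℝ) 1
    refine (integrable_congr (Filter.Eventually.of_forall fun x => ?_)).1 h
    rw [pow_one, Real.norm_eq_abs,
      show ((𝓕 f : SchwartzMap ℝ ℂ) : ℝ → ℂ) x = 𝓕 (f : ℝ → ℂ) x from
        congrFun (SchwartzMap.fourier_coe f) x]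
  -- the kernel in sheared coordinates `(u, η) = (ξ − η, η)`
  set g : ℝ × ℝ → ℝ := fun p => ‖𝓕 (f : ℝ → ℂ) p.1 *
    ((if 0 < p.1 + p.2 ∧ p.2 ≤ 0 then (1 : ℂ) else 0) - (if p.1 + p.2 ≤ 0 ∧ 0 < p.2 then (1 : ℂ) else 0))‖ ^ 2
    with hg
  have hmeas := measurable_quadrantKernel f
  rw [memLp_two_iff_integrable_sq_norm hmeas.aestronglyMeasurable]
  -- `‖b_f‖² = g ∘ (ξ,η) ↦ (ξ − η, η)`, a measure-preserving shear
  have hcomp : (fun z : ℝ × ℝ => ‖Function.uncurry (fun ξ η : ℝ => 𝓕 (f : ℝ → ℂ) (ξ - η) *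
      ((if 0 < ξ ∧ η ≤ 0 then (1 : ℂ) else 0) - (if ξ ≤ 0 ∧ 0 < η then (1 : ℂ) else 0))) z‖ ^ 2) =
      g ∘ fun z : ℝ × ℝ => (z.1 - z.2, z.2) := by
    funext z
    rcases z with ⟨ξ, η⟩
    simp only [hg, Function.comp_apply, Function.uncurry_apply_pair, sub_add_cancel]
  have hgmeas : Measurable g := by
    refine (((hFcont.measurable.comp measurable_fst).mul (Measurable.sub ?_ ?_)).norm.pow_const 2)
    · refine Measurable.ite ?_ measurable_const measurable_const
      exact (measurableSet_lt measurable_const (measurable_fst.add measurable_snd)).inter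
        (measurableSet_le measurable_snd measurable_const)
    · refine Measurable.ite ?_ measurable_const measurable_const
      exact (measurableSet_le (measurable_fst.add measurable_snd) measurable_const).inter
        (measurableSet_lt measurable_const measurable_snd)
  rw [hcomp, (measurePreserving_sub_prod (volume : Measure ℝ) (volume : Measure ℝ)).integrable_comp
    hgmeas.aestronglyMeasurable]
  -- domination `g(u, η) ≤ C0 ‖f̂(u)‖ 1_{[−|u|, |u|]}(η)`
  have hbound : ∀ p : ℝ × ℝ, ‖g p‖ ≤ C0 * ‖𝓕 (f : ℝ → ℂ) p.1‖ *
      (Icc (-|p.1|) |p.1|).indicator (fun _ => (1 : ℝ)) p.2 := by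
    rintro ⟨u, η⟩
    have hgp : g (u, η) = (‖𝓕 (f : ℝ → ℂ) u‖ * ‖(if 0 < u + η ∧ η ≤ 0 then (1 : ℂ) else 0) -
        (if u + η ≤ 0 ∧ 0 < η then (1 : ℂ) else 0)‖) ^ 2 := by
      simp only [hg, norm_mul]
    rw [Real.norm_of_nonneg (by rw [hgp]; positivity), hgp]
    by_cases hη : η ∈ Icc (-|u|) |u|
    · rw [Set.indicator_of_mem hη, mul_one]
      have hW : ‖(if 0 < u + η ∧ η ≤ 0 then (1 : ℂ) else 0) - (if u + η ≤ 0 ∧ 0 < η then (1 : ℂ) else 0)‖ ≤ 1 := by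
        split_ifs <;> simp
      calc (‖𝓕 (f : ℝ → ℂ) u‖ * ‖(if 0 < u + η ∧ η ≤ 0 then (1 : ℂ) else 0) -
            (if u + η ≤ 0 ∧ 0 < η then (1 : ℂ) else 0)‖) ^ 2
          ≤ (‖𝓕 (f : ℝ → ℂ) u‖ * 1) ^ 2 := by gcongr
        _ = ‖𝓕 (f : ℝ → ℂ) u‖ * ‖𝓕 (f : ℝ → ℂ) u‖ := by ring
        _ ≤ C0 * ‖𝓕 (f : ℝ → ℂ) u‖ := by gcongr; exact hC0 u
    · have hA : ¬ (0 < u + η ∧ η ≤ 0) := fun h =>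
        hη (Set.mem_Icc.2 ⟨by linarith [le_abs_self u, h.1], by linarith [abs_nonneg u, h.2]⟩)
      have hB : ¬ (u + η ≤ 0 ∧ 0 < η) := fun h =>
        hη (Set.mem_Icc.2 ⟨by linarith [abs_nonneg u, h.2], by linarith [neg_abs_le u, h.1]⟩)
      simp [if_neg hA, if_neg hB, Set.indicator_of_notMem hη]
  refine Integrable.mono' (g := fun p : ℝ × ℝ => C0 * ‖𝓕 (f : ℝ → ℂ) p.1‖ *
      (Icc (-|p.1|) |p.1|).indicator (fun _ => (1 : ℝ)) p.2) ?_ hgmeas.aestronglyMeasurable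
    (Filter.Eventually.of_forall hbound)
  -- integrability of the dominating function (sections + `∫ = 2|u| C0 ‖f̂ u‖`)
  have hmeas2 : AEStronglyMeasurable (fun p : ℝ × ℝ =>
      C0 * ‖𝓕 (f : ℝ → ℂ) p.1‖ * (Icc (-|p.1|) |p.1|).indicator (fun _ => (1 : ℝ)) p.2)
      ((volume : Measure ℝ).prod volume) := by
    refine Measurable.aestronglyMeasurable
      ((measurable_const.mul (hFcont.measurable.comp measurable_fst).norm).mul ?_)
    have hset : MeasurableSet {p : ℝ × ℝ | p.2 ∈ Icc (-|p.1|) |p.1|} :=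
      (measurableSet_le ((continuous_abs.measurable.comp measurable_fst).neg) measurable_snd).inter
        (measurableSet_le measurable_snd (continuous_abs.measurable.comp measurable_fst))
    exact (measurable_const.indicator hset : Measurable fun p : ℝ × ℝ =>
      Set.indicator {p : ℝ × ℝ | p.2 ∈ Icc (-|p.1|) |p.1|} (fun _ => (1 : ℝ)) p)
  rw [integrable_prod_iff hmeas2]
  constructor
  · refine Filter.Eventually.of_forall fun u => ?_
    have h1 : Integrable ((Icc (-|u|) |u|).indicator fun _ : ℝ => (1 : ℝ)) (volume : Measure ℝ) :=
      (integrable_indicator_iff measurableSet_Icc).2 continuous_const.integrableOn_Icc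
    simpa using h1.const_mul (C0 * ‖𝓕 (f : ℝ → ℂ) u‖)
  · have heq : (fun u : ℝ => ∫ η : ℝ, ‖C0 * ‖𝓕 (f : ℝ → ℂ) u‖ *
        (Icc (-|u|) |u|).indicator (fun _ => (1 : ℝ)) η‖) = fun u => C0 * (|u| * ‖𝓕 (f : ℝ → ℂ) u‖) * 2 := by
      funext u
      have hnn : ∀ η, 0 ≤ C0 * ‖𝓕 (f : ℝ → ℂ) u‖ * (Icc (-|u|) |u|).indicator (fun _ => (1 : ℝ)) η :=
        fun η => mul_nonneg (mul_nonneg hC0nn (norm_nonneg _))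
          (Set.indicator_nonneg (fun _ _ => zero_le_one) _)
      simp_rw [Real.norm_of_nonneg (hnn _)]
      rw [integral_const_mul, integral_indicator_const _ measurableSet_Icc, smul_eq_mul, mul_one,
        Real.volume_real_Icc_of_le (by linarith [abs_nonneg u])]
      ring
    rw [heq]
    exact (hF1.const_mul C0).mul_const 2

/-- RH-FREE. **The frequency-side kernel of `[H, f]` is integrable on `ℝ²`**: `b_f ∈ L¹(ℝ × ℝ)`
(`∫∫|b_f| ≤ ∫ 2|u||f̂(u)| du`), the absolute convergence behind the Fubini exchanges identifying
`⟨Bφ̂, ψ̂⟩` with `⟨[H,f]φ, ψ⟩` for Schwartz `φ, ψ`.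
[cite: ConnesConsani2021, App. D Lemma 47 proof p. 33 (arXiv chunk p0033:L24–36)] -/
theorem integrable_quadrantKernel (f : SchwartzMap ℝ ℂ) :
    Integrable (Function.uncurry fun ξ η : ℝ => 𝓕 (f : ℝ → ℂ) (ξ - η) *
      ((if 0 < ξ ∧ η ≤ 0 then (1 : ℂ) else 0) - (if ξ ≤ 0 ∧ 0 < η then (1 : ℂ) else 0)))
      ((volume : Measure ℝ).prod volume) := by
  have hFcont : Continuous (𝓕 (f : ℝ → ℂ)) := by
    simpa [SchwartzMap.fourier_coe] using (𝓕 f).continuous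
  have hF1 : Integrable (fun u : ℝ => |u| * ‖𝓕 (f : ℝ → ℂ) u‖) := by
    have h := (𝓕 f).integrable_pow_mul (volume : Measure ℝ) 1
    refine (integrable_congr (Filter.Eventually.of_forall fun x => ?_)).1 h
    rw [pow_one, Real.norm_eq_abs,
      show ((𝓕 f : SchwartzMap ℝ ℂ) : ℝ → ℂ) x = 𝓕 (f : ℝ → ℂ) x from
        congrFun (SchwartzMap.fourier_coe f) x]
  -- sheared coordinates `(u, η) = (ξ − η, η)`
  set g : ℝ × ℝ → ℂ := fun p => 𝓕 (f : ℝ → ℂ) p.1 *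
    ((if 0 < p.1 + p.2 ∧ p.2 ≤ 0 then (1 : ℂ) else 0) - (if p.1 + p.2 ≤ 0 ∧ 0 < p.2 then (1 : ℂ) else 0))
    with hg
  have hcomp : (Function.uncurry fun ξ η : ℝ => 𝓕 (f : ℝ → ℂ) (ξ - η) *
      ((if 0 < ξ ∧ η ≤ 0 then (1 : ℂ) else 0) - (if ξ ≤ 0 ∧ 0 < η then (1 : ℂ) else 0))) =
      g ∘ fun z : ℝ × ℝ => (z.1 - z.2, z.2) := by
    funext z
    rcases z with ⟨ξ, η⟩
    simp only [hg, Function.comp_apply, Function.uncurry_apply_pair, sub_add_cancel]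
  have hgmeas : Measurable g := by
    refine ((hFcont.measurable.comp measurable_fst).mul (Measurable.sub ?_ ?_))
    · refine Measurable.ite ?_ measurable_const measurable_const
      exact (measurableSet_lt measurable_const (measurable_fst.add measurable_snd)).inter
        (measurableSet_le measurable_snd measurable_const)
    · refine Measurable.ite ?_ measurable_const measurable_const
      exact (measurableSet_le (measurable_fst.add measurable_snd) measurable_const).inter
        (measurableSet_lt measurable_const measurable_snd)
  rw [hcomp, (measurePreserving_sub_prod (volume : Measure ℝ) (volume : Measure ℝ)).integrable_comp
    hgmeas.aestronglyMeasurable]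
  -- domination `‖g(u, η)‖ ≤ ‖f̂(u)‖ 1_{[−|u|, |u|]}(η)`
  have hbound : ∀ p : ℝ × ℝ, ‖g p‖ ≤ ‖𝓕 (f : ℝ → ℂ) p.1‖ *
      (Icc (-|p.1|) |p.1|).indicator (fun _ => (1 : ℝ)) p.2 := by
    rintro ⟨u, η⟩
    simp only [hg, norm_mul]
    by_cases hη : η ∈ Icc (-|u|) |u|
    · rw [Set.indicator_of_mem hη, mul_one]
      refine mul_le_of_le_one_right (norm_nonneg _) ?_
      split_ifs <;> simp
    · have hA : ¬ (0 < u + η ∧ η ≤ 0) := fun h =>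
        hη (Set.mem_Icc.2 ⟨by linarith [le_abs_self u, h.1], by linarith [abs_nonneg u, h.2]⟩)
      have hB : ¬ (u + η ≤ 0 ∧ 0 < η) := fun h =>
        hη (Set.mem_Icc.2 ⟨by linarith [abs_nonneg u, h.2], by linarith [neg_abs_le u, h.1]⟩)
      simp [if_neg hA, if_neg hB, Set.indicator_of_notMem hη]
  refine Integrable.mono' (g := fun p : ℝ × ℝ => ‖𝓕 (f : ℝ → ℂ) p.1‖ *
      (Icc (-|p.1|) |p.1|).indicator (fun _ => (1 : ℝ)) p.2) ?_ hgmeas.aestronglyMeasurable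
    (Filter.Eventually.of_forall hbound)
  have hmeas2 : AEStronglyMeasurable (fun p : ℝ × ℝ =>
      ‖𝓕 (f : ℝ → ℂ) p.1‖ * (Icc (-|p.1|) |p.1|).indicator (fun _ => (1 : ℝ)) p.2)
      ((volume : Measure ℝ).prod volume) := by
    refine Measurable.aestronglyMeasurable ((hFcont.measurable.comp measurable_fst).norm.mul ?_)
    have hset : MeasurableSet {p : ℝ × ℝ | p.2 ∈ Icc (-|p.1|) |p.1|} :=
      (measurableSet_le ((continuous_abs.measurable.comp measurable_fst).neg) measurable_snd).inter
        (measurableSet_le measurable_snd (continuous_abs.measurable.comp measurable_fst))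
    exact (measurable_const.indicator hset : Measurable fun p : ℝ × ℝ =>
      Set.indicator {p : ℝ × ℝ | p.2 ∈ Icc (-|p.1|) |p.1|} (fun _ => (1 : ℝ)) p)
  rw [integrable_prod_iff hmeas2]
  constructor
  · refine Filter.Eventually.of_forall fun u => ?_
    have h1 : Integrable ((Icc (-|u|) |u|).indicator fun _ : ℝ => (1 : ℝ)) (volume : Measure ℝ) :=
      (integrable_indicator_iff measurableSet_Icc).2 continuous_const.integrableOn_Icc
    simpa using h1.const_mul ‖𝓕 (f : ℝ → ℂ) u‖
  · have heq : (fun u : ℝ => ∫ η : ℝ, ‖‖𝓕 (f : ℝ → ℂ) u‖ *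
        (Icc (-|u|) |u|).indicator (fun _ => (1 : ℝ)) η‖) = fun u => |u| * ‖𝓕 (f : ℝ → ℂ) u‖ * 2 := by
      funext u
      have hnn : ∀ η, 0 ≤ ‖𝓕 (f : ℝ → ℂ) u‖ * (Icc (-|u|) |u|).indicator (fun _ => (1 : ℝ)) η :=
        fun η => mul_nonneg (norm_nonneg _) (Set.indicator_nonneg (fun _ _ => zero_le_one) _)
      simp_rw [Real.norm_of_nonneg (hnn _)]
      rw [integral_const_mul, integral_indicator_const _ measurableSet_Icc, smul_eq_mul, mul_one,
        Real.volume_real_Icc_of_le (by linarith [abs_nonneg u])]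
      ring
    rw [heq]
    exact hF1.mul_const 2

end Literature.NumberTheory.ConnesConsani2021
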